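import Literature.Dynamics.SymbolicDynamics.CoinsAndBuckets
import Literature.Dynamics.SymbolicDynamics.StrongIrreducibility
import Mathlib.Data.ZMod.Basic
import HarnessLib

/-!
# Hochman 2025: unorientability, compatible frames (§5.6, Lemma 5.5) and the gluing set-up (§6.1)

Further proved pieces of the printed proof of Thm. 1.1 of M. Hochman, *Irreducibility and
periodicity in `ℤ²` symbolic systems* (Discrete Analysis 2025:17), on top of
`CoinsAndBuckets.lean` (§3, Prop. 3.1) and `StrongIrreducibility.lean`:

* §3, "unorientable": `CoinsAndBuckets.IsUnorientable c` — no finite sequence of legal moves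
  leads from `c` to an oriented configuration. By its very definition it is ROBUST under legal
  moves (`IsUnorientable.move`), which is how aperiodicity survives gluing in §6, and Prop. 3.1
  reads `IsUnorientable (c_{k,n})` for `n ≥ 2^k` (`isUnorientable_ckn`).
* §5.6, "Compatibility": the coin-and-bucket configuration `CBC(x, F)` of a configuration
  `x ∈ ({H,T}^C)^{ℤ²}` (one Boolean layer per class `c ∈ C`; in the paper `C = Θ × Σ`) at a finite
  family of witnesses, a witness being a site together with its class: buckets are indexed by
  `(ℤ/nℤ)² × C` (read through a fixed enumeration `e : (ℤ/nℤ)² × C ≃ Fin k`, since the game of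
  `CoinsAndBuckets.lean` has buckets `Fin k`), and the witness `(w, c)` contributes a coin of
  orientation `x w c` to the bucket `([w] mod n, c)` — `Hochman2025.cbc`.
* Lemma 5.5 (at the level of one frame): if `CBC` is not oriented — in particular if it is
  unorientable — then two witnesses of the same class lie in the same residue class modulo `n`
  and carry different symbols: an `n`-aperiodic pair (`Hochman2025.exists_pair_of_not_isOriented`,
  `Hochman2025.exists_pair_of_isUnorientable`).
* Lemma 5.8 (the realizability step): every prescribed orientation of the coins of a witness
  family is realized by some configuration, the symbols at distinct (site, class) pairs being
  independent (`Hochman2025.cbc_realize`).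
* §6.1–6.2 set-up: to glue along finite `E, F` with `d(E,F) > g` it suffices to glue `y|_F` into
  `x` restricted to the WHOLE far region `{u | ∀ q ∈ F, d(u,q) > g}` (Hochman: "`E_x = {u ∈ ℤ² |
  d(u, E_y) > 3}`"), because gluing is monotone in `E`
  (`isFinitelyStronglyIrreducible_of_far`).

## References

* [Hochman2025] M. Hochman, *Irreducibility and periodicity in `ℤ²` symbolic systems*, Discrete
  Analysis 2025:17 — §3 (p. 8, "orientable/unorientable"), §5.5–5.7 (pp. 23–25: alphabet,
  compatibility, Lemmas 5.5, 5.8), §6.1–6.2 (pp. 25–28). Read via `lit read arxiv:2401.02273`.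
-/

open Finset

namespace Literature.Dynamics.SymbolicDynamics

/-! ### Unorientability (§3) -/

namespace CoinsAndBuckets

/-- A coin-and-bucket configuration is *unorientable* (Hochman §3): no finite sequence of legal
moves leads from it to an oriented configuration. [cite: Hochman2025, §3] -/
def IsUnorientable {k : ℕ} (c : Config k) : Prop :=
  ∀ c' : Config k, Relation.ReflTransGen Move c c' → ¬ IsOriented c'.heads c'.tails

/-- An unorientable configuration is not oriented. [folklore] -/
theorem IsUnorientable.not_isOriented {k : ℕ} {c : Config k} (h : IsUnorientable c) :
    ¬ IsOriented c.heads c.tails :=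
  h c Relation.ReflTransGen.refl

/-- **Robustness**: unorientability is preserved by every legal move (by definition).
[cite: Hochman2025, §3] -/
theorem IsUnorientable.move {k : ℕ} {c c' : Config k} (h : IsUnorientable c) (hm : Move c c') :
    IsUnorientable c' :=
  fun c'' hc'' => h c'' (Relation.ReflTransGen.head hm hc'')

/-- Unorientability is preserved along finite sequences of legal moves. [folklore] -/
theorem IsUnorientable.reflTransGen {k : ℕ} {c c' : Config k} (h : IsUnorientable c)
    (hm : Relation.ReflTransGen Move c c') : IsUnorientable c' :=
  fun c'' hc'' => h c'' (hm.trans hc'')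

/-- **Prop. 3.1** in this vocabulary: `c_{k,n}` is unorientable for `n ≥ 2^k`.
[cite: Hochman2025, Prop 3.1] -/
theorem isUnorientable_ckn {k n : ℕ} (hk : 0 < k) (hn : 2 ^ k ≤ n) :
    IsUnorientable (ckn k n hk) :=
  fun _ hc => Hochman2025_prop_3_1 hk hn hc

end CoinsAndBuckets

/-! ### Compatible frames (§5.6) and Lemma 5.5 -/

namespace Hochman2025

variable {C : Type*}

/-- The residue-and-class label of a witness `(w, c)`: `([w] mod n, c) ∈ (ℤ/nℤ)² × C`.
[cite: Hochman2025, §5.6] -/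
def label (n : ℕ) (wc : (ℤ × ℤ) × C) : (ZMod n × ZMod n) × C :=
  (((wc.1.1 : ZMod n), (wc.1.2 : ZMod n)), wc.2)

/-- **`CBC(x, F)`** (Hochman §5.6) for a finite family `W` of witnesses `(w, c)` (site, class) of
an `n`-frame and a configuration `x` with one Boolean layer per class: the bucket of `(w, c)` is
`([w] mod n, c)`, read in `Fin k` through the enumeration `e`, and its coin shows heads iff
`x w c = true`. [cite: Hochman2025, §5.6] -/
def cbc {n k : ℕ} (e : (ZMod n × ZMod n) × C ≃ Fin k) (x : ℤ × ℤ → C → Bool)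
    (W : Finset ((ℤ × ℤ) × C)) : CoinsAndBuckets.Config k where
  heads b := (W.filter fun wc => e (label n wc) = b ∧ x wc.1 wc.2 = true).card
  tails b := (W.filter fun wc => e (label n wc) = b ∧ x wc.1 wc.2 = false).card

/-- Equal labels = same class and congruent sites. [folklore] -/
theorem label_eq_label_iff (n : ℕ) (u v : (ℤ × ℤ) × C) :
    label n u = label n v ↔
      (n : ℤ) ∣ u.1.1 - v.1.1 ∧ (n : ℤ) ∣ u.1.2 - v.1.2 ∧ u.2 = v.2 := by
  simp only [label, Prod.mk.injEq]
  rw [eq_comm (a := (u.1.1 : ZMod n)), eq_comm (a := (u.1.2 : ZMod n)),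
    ZMod.intCast_eq_intCast_iff_dvd_sub, ZMod.intCast_eq_intCast_iff_dvd_sub]
  tauto

/-- **Lemma 5.5 (one frame)**: if `CBC(x, F)` is not oriented, two witnesses of `F` of the same
class lie in the same residue class modulo `n` and carry different symbols in that layer — in
particular `x` takes different values at two sites congruent modulo `n` (an `n`-aperiodic pair).
[cite: Hochman2025, Lemma 5.5] -/
theorem exists_pair_of_not_isOriented {n k : ℕ} (e : (ZMod n × ZMod n) × C ≃ Fin k)
    (x : ℤ × ℤ → C → Bool) (W : Finset ((ℤ × ℤ) × C))
    (h : ¬ CoinsAndBuckets.IsOriented (cbc e x W).heads (cbc e x W).tails) :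
    ∃ u ∈ W, ∃ v ∈ W, u.2 = v.2 ∧ (n : ℤ) ∣ u.1.1 - v.1.1 ∧ (n : ℤ) ∣ u.1.2 - v.1.2 ∧
      x u.1 u.2 = true ∧ x v.1 v.2 = false ∧ x u.1 ≠ x v.1 := by
  simp only [CoinsAndBuckets.IsOriented, not_forall, not_or] at h
  obtain ⟨b, hb1, hb2⟩ := h
  obtain ⟨u, hu, hue, hux⟩ : ∃ u ∈ W, e (label n u) = b ∧ x u.1 u.2 = true := by
    have : (W.filter fun wc => e (label n wc) = b ∧ x wc.1 wc.2 = true).Nonempty :=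
      Finset.nonempty_iff_ne_empty.mpr fun h0 => hb1 (by simp [cbc, h0])
    obtain ⟨u, hu⟩ := this
    exact ⟨u, (Finset.mem_filter.mp hu).1, (Finset.mem_filter.mp hu).2⟩
  obtain ⟨v, hv, hve, hvx⟩ : ∃ v ∈ W, e (label n v) = b ∧ x v.1 v.2 = false := by
    have : (W.filter fun wc => e (label n wc) = b ∧ x wc.1 wc.2 = false).Nonempty :=
      Finset.nonempty_iff_ne_empty.mpr fun h0 => hb2 (by simp [cbc, h0])
    obtain ⟨v, hv⟩ := this
    exact ⟨v, (Finset.mem_filter.mp hv).1, (Finset.mem_filter.mp hv).2⟩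
  have hlab : label n u = label n v := e.injective (hue.trans hve.symm)
  obtain ⟨h1, h2, h3⟩ := (label_eq_label_iff n u v).mp hlab
  refine ⟨u, hu, v, hv, h3, h1, h2, hux, hvx, fun heq => ?_⟩
  have : x u.1 u.2 = x v.1 v.2 := by rw [heq, h3]
  rw [hux, hvx] at this
  exact Bool.noConfusion this

/-- Lemma 5.5 for a *compatible* frame (unorientable `CBC`): an `n`-aperiodic pair among its
witnesses. [cite: Hochman2025, Lemma 5.5] -/
theorem exists_pair_of_isUnorientable {n k : ℕ} (e : (ZMod n × ZMod n) × C ≃ Fin k)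
    (x : ℤ × ℤ → C → Bool) (W : Finset ((ℤ × ℤ) × C))
    (h : CoinsAndBuckets.IsUnorientable (cbc e x W)) :
    ∃ u ∈ W, ∃ v ∈ W, (n : ℤ) ∣ u.1.1 - v.1.1 ∧ (n : ℤ) ∣ u.1.2 - v.1.2 ∧ x u.1 ≠ x v.1 := by
  obtain ⟨u, hu, v, hv, -, h1, h2, -, -, hne⟩ := exists_pair_of_not_isOriented e x W
    h.not_isOriented
  exact ⟨u, hu, v, hv, h1, h2, hne⟩

/-- **Realizability (the step of Lemma 5.8)**: the symbols at distinct (site, class) pairs are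
independent, so any prescribed orientation `o` of the coins of a witness family is realized:
the configuration `x w c = o (w, c)` (and `false` off `W`) has, in each bucket, exactly the
prescribed numbers of heads and tails. [cite: Hochman2025, Lemma 5.8] -/
theorem cbc_realize [DecidableEq C] {n k : ℕ} (e : (ZMod n × ZMod n) × C ≃ Fin k)
    (W : Finset ((ℤ × ℤ) × C)) (o : (ℤ × ℤ) × C → Bool) :
    cbc e (fun w c => if (w, c) ∈ W then o (w, c) else false) W =
      ⟨fun b => (W.filter fun wc => e (label n wc) = b ∧ o wc = true).card,
        fun b => (W.filter fun wc => e (label n wc) = b ∧ o wc = false).card⟩ := by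
  simp only [cbc, CoinsAndBuckets.Config.mk.injEq]
  constructor
  · funext b
    congr 1
    refine Finset.filter_congr fun wc hwc => ?_
    simp [hwc]
  · funext b
    congr 1
    refine Finset.filter_congr fun wc hwc => ?_
    simp [hwc]

end Hochman2025

/-! ### The gluing set-up of §6.1–6.2: gluing into the whole far region -/

/-- **It suffices to glue into the whole far region.** If for every finite `F` and all `x, y ∈ X`
there is `z ∈ X` with `z = y` on `F` and `z = x` at EVERY site at distance `> g` from all of `F`
(Hochman §6.2: "`E_x = {u ∈ ℤ² | d(u, E_y) > 3}`"), then `X` is strongly irreducible with gap `g`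
along finite sets: any finite `E` with `d(E, F) > g` lies in that far region, and gluing is
monotone in `E`. [cite: Hochman2025, §6.1–6.2] -/
theorem isFinitelyStronglyIrreducible_of_far {A G : Type*} [Dist G] {X : Set (G → A)} {g : ℝ}
    (h : ∀ F : Finset G, AdmitsGluing X {p | ∀ q ∈ F, g < dist p q} (F : Set G)) :
    IsFinitelyStronglyIrreducible X g :=
  fun _ F hEF => (h F).mono (fun p hp q hq => hEF p hp q hq) subset_rfl

end Literature.Dynamics.SymbolicDynamics
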